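import Summits.KontsevichZagierPeriods.KontsevichZagierPeriods.Theorems.HurwitzMicroSectorsNormalFormPrincipleM4SharedTools
import Summits.KontsevichZagierPeriods.KontsevichZagierPeriods.Theorems.HyperbolicBlochOffTetraSectorKernelStubAffineOrbit
import Literature.NumberTheory.Transcendental.KZProductIdeal

/-!
# `NormalFormPrinciple` (stmt-KontsevichZagierPeriods-3869), line `SketchIdeator1` —
# leaf `stub_boxRigidity`, layer `Island`: the triple-pole atom at height `q`

The PRODUCT ISLAND at height `q` (`q : ℕ`, `2 ≤ q`), dimension two, on the open unit box
`□² = {x | ∀ i, x i ∈ (0,1)}`. The atoms involved are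
`Tq = [□², q(q−1)/((q−x₀)(q−x₁)(q−x₀x₁))]`, `D = [□², 1/(q−x₀x₁)]`,
`Vq = [□², q/((q−x₀)(q−x₀x₁))]`, its mirror image `Vq' = [□², q/((q−x₁)(q−x₀x₁))]`, and
`P = [□², 1/((q−x₀)(q−x₁))]`.

* The PARTIAL FRACTION identity
  `q(q−1)/((q−x)(q−y)(q−xy)) = −1/(q−xy) + q/((q−x)(q−xy)) + q/((q−y)(q−xy)) − 1/((q−x)(q−y))`
  (`islT_partialFraction`; all denominators are `≥ q − 1 ≥ 1` on the box) says that pointwise on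
  `□²` the integrand of `Tq` is the `ℤ`-combination `−D + Vq + Vq' − P` of the four other
  integrands, so `[Tq] + [D] − [Vq] − [Vq'] + [P]` is a relation by iterated integrand additivity
  (Kontsevich–Zagier's rule (1b), in the `ℤ`-combination form
  `aff_orbit_of_sub_sum_zsmul_mem_relations`).
* The coordinate swap `x₀ ↔ x₁` (rule (2), as the reindexing move
  `KZ.of_sub_of_reindex_mem_relations`) followed by the same-domain congruence gives
  `[Vq'] − [Vq] ∈ relations`.

Sources: M. Kontsevich, D. Zagier, *Periods* (2001), §1.1–1.2, rules (1), (2).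
No definitions are introduced.
-/

noncomputable section

open MeasureTheory Set
open Literature.NumberTheory.Transcendental Literature.NumberTheory.Transcendental.KZ
open Summit.KontsevichZagierPeriods.HyperbolicBloch.OffTetraSectorKernel
  (aff_orbit_of_sub_sum_zsmul_mem_relations)

namespace Summit.KontsevichZagierPeriods.HurwitzMicroSectors.NormalFormPrinciple.PiBox.Island

/-! ## Scalar facts -/

/-- **The partial fraction of the triple pole.** For `q − a`, `q − b`, `q − ab` nonzero,
`q(q−1)/((q−a)(q−b)(q−ab)) = −1/(q−ab) + q/((q−a)(q−ab)) + q/((q−b)(q−ab)) − 1/((q−a)(q−b))`.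
[folklore] -/
theorem islT_partialFraction {q a b : ℝ} (ha : q - a ≠ 0) (hb : q - b ≠ 0)
    (hab : q - a * b ≠ 0) :
    q * (q - 1) / ((q - a) * (q - b) * (q - a * b)) =
      -(1 / (q - a * b)) + q / ((q - a) * (q - a * b)) + q / ((q - b) * (q - a * b)) -
        1 / ((q - a) * (q - b)) := by
  field_simp
  ring

/-- On the open unit box the three denominators `q − x₀`, `q − x₁`, `q − x₀x₁` of the island at
height `q ≥ 2` do not vanish (they are `≥ q − 1 ≥ 1`). [folklore] -/
theorem islT_den_ne_zero {q : ℕ} (hq : 2 ≤ q) {x : Fin 2 → ℝ}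
    (hx : ∀ i, x i ∈ Set.Ioo (0:ℝ) 1) :
    (q:ℝ) - x 0 ≠ 0 ∧ (q:ℝ) - x 1 ≠ 0 ∧ (q:ℝ) - x 0 * x 1 ≠ 0 := by
  have hq' : (2:ℝ) ≤ q := by exact_mod_cast hq
  have h0 := hx 0
  have h1 := hx 1
  have h01 : x 0 * x 1 < 1 := mul_lt_one_of_nonneg_of_lt_one_left h0.1.le h0.2 h1.2.le
  exact ⟨(sub_pos.2 (by linarith [h0.2])).ne', (sub_pos.2 (by linarith [h1.2])).ne',
    (sub_pos.2 (by linarith)).ne'⟩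

/-! ## The two moves -/

/-- **Rule (1b) for the triple pole.** If `Tq, D, Vq, Vq', P` are box representations with the
island integrands, then `[Tq] + [D] − [Vq] − [Vq'] + [P] ∈ relations`: on `□²` the integrand of
`Tq` is the `ℤ`-combination `−D + Vq + Vq' − P` (`islT_partialFraction`), and `ℤ`-combinations on a
common domain collapse by iterated integrand additivity.
[cite: KontsevichZagier2001, §1.2 rules (1), (2)] -/
theorem islT_triplePole_mem_relations {q : ℕ} (hq : 2 ≤ q) (Tq D Vq Vq' P : IntegralRep 2)
    (hTd : Tq.domain = {x | ∀ i, x i ∈ Set.Ioo (0:ℝ) 1})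
    (hTi : EqOn Tq.integrand (fun x => (q:ℝ) * ((q:ℝ) - 1) /
      (((q:ℝ) - x 0) * ((q:ℝ) - x 1) * ((q:ℝ) - x 0 * x 1))) Tq.domain)
    (hDd : D.domain = {x | ∀ i, x i ∈ Set.Ioo (0:ℝ) 1})
    (hDi : EqOn D.integrand (fun x => 1 / ((q:ℝ) - x 0 * x 1)) D.domain)
    (hVd : Vq.domain = {x | ∀ i, x i ∈ Set.Ioo (0:ℝ) 1})
    (hVi : EqOn Vq.integrand (fun x => (q:ℝ) / (((q:ℝ) - x 0) * ((q:ℝ) - x 0 * x 1))) Vq.domain)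
    (hV'd : Vq'.domain = {x | ∀ i, x i ∈ Set.Ioo (0:ℝ) 1})
    (hV'i : EqOn Vq'.integrand (fun x => (q:ℝ) / (((q:ℝ) - x 1) * ((q:ℝ) - x 0 * x 1)))
      Vq'.domain)
    (hPd : P.domain = {x | ∀ i, x i ∈ Set.Ioo (0:ℝ) 1})
    (hPi : EqOn P.integrand (fun x => 1 / (((q:ℝ) - x 0) * ((q:ℝ) - x 1))) P.domain) :
    of Tq + of D - of Vq - of Vq' + of P ∈ relations := by
  have hsplit : of Tq - ((-1:ℤ) • of D + (1:ℤ) • of Vq + (1:ℤ) • of Vq' + (-1:ℤ) • of P) ∈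
      relations := by
    have h := aff_orbit_of_sub_sum_zsmul_mem_relations (Finset.univ : Finset (Fin 4))
      ![D, Vq, Vq', P] ![-1, 1, 1, -1] Tq (fun i _ => by
        fin_cases i
        · exact hDd.trans hTd.symm
        · exact hVd.trans hTd.symm
        · exact hV'd.trans hTd.symm
        · exact hPd.trans hTd.symm) fun x hx => ?_
    · simpa [Fin.sum_univ_four] using h
    have hx' : ∀ i, x i ∈ Set.Ioo (0:ℝ) 1 := by
      rw [hTd] at hx
      exact hx
    have hxD : x ∈ D.domain := by
      rw [hDd]
      exact hx'
    have hxV : x ∈ Vq.domain := by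
      rw [hVd]
      exact hx'
    have hxV' : x ∈ Vq'.domain := by
      rw [hV'd]
      exact hx'
    have hxP : x ∈ P.domain := by
      rw [hPd]
      exact hx'
    obtain ⟨h0, h1, h01⟩ := islT_den_ne_zero hq hx'
    rw [hTi hx]
    simp only [Fin.sum_univ_four, Matrix.cons_val_zero, Matrix.cons_val_one, Matrix.cons_val_two,
      Matrix.cons_val_three, Matrix.head_cons, Matrix.tail_cons, hDi hxD, hVi hxV, hV'i hxV',
      hPi hxP]
    rw [islT_partialFraction h0 h1 h01]
    push_cast
    ring
  have e : of Tq + of D - of Vq - of Vq' + of P =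
      of Tq - ((-1:ℤ) • of D + (1:ℤ) • of Vq + (1:ℤ) • of Vq' + (-1:ℤ) • of P) := by
    abel
  rw [e]
  exact hsplit

/-- **The coordinate swap (rule (2)).** If `Vq = [□², q/((q−x₀)(q−x₀x₁))]` and
`Vq' = [□², q/((q−x₁)(q−x₀x₁))]`, then `[Vq'] − [Vq] ∈ relations`: the swap `x₀ ↔ x₁` is the
reindexing move `[Vq] − [Vq ∘ swap]`, and `Vq ∘ swap` has the domain and (on it) the integrand of
`Vq'`. [cite: KontsevichZagier2001, §1.2 rules (1), (2)] -/
theorem islT_swap_mem_relations (q : ℕ) (Vq Vq' : IntegralRep 2)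
    (hVd : Vq.domain = {x | ∀ i, x i ∈ Set.Ioo (0:ℝ) 1})
    (hVi : EqOn Vq.integrand (fun x => (q:ℝ) / (((q:ℝ) - x 0) * ((q:ℝ) - x 0 * x 1))) Vq.domain)
    (hV'd : Vq'.domain = {x | ∀ i, x i ∈ Set.Ioo (0:ℝ) 1})
    (hV'i : EqOn Vq'.integrand (fun x => (q:ℝ) / (((q:ℝ) - x 1) * ((q:ℝ) - x 0 * x 1)))
      Vq'.domain) :
    of Vq' - of Vq ∈ relations := by
  have h1 := of_sub_of_reindex_mem_relations Vq (Equiv.swap (0 : Fin 2) 1)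
  have hd : (Vq.reindex (Equiv.swap (0 : Fin 2) 1)).domain = {x | ∀ i, x i ∈ Set.Ioo (0:ℝ) 1} := by
    ext w
    simp only [IntegralRep.reindex_domain, hVd, mem_setOf_eq, Fin.forall_fin_two,
      Equiv.swap_apply_left, Equiv.swap_apply_right]
    tauto
  have h2 : of (Vq.reindex (Equiv.swap (0 : Fin 2) 1)) - of Vq' ∈ relations := by
    refine of_sub_of_mem_relations_of_eqOn (hV'd.trans hd.symm) fun w hw => ?_
    have hw' : (fun i => w (Equiv.swap (0 : Fin 2) 1 i)) ∈ Vq.domain := by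
      rw [IntegralRep.reindex_domain] at hw
      exact hw
    rw [IntegralRep.reindex_integrand]
    show Vq.integrand (fun i => w (Equiv.swap (0 : Fin 2) 1 i)) = Vq'.integrand w
    rw [hVi hw', hV'i (hV'd ▸ hd ▸ hw)]
    simp only [Equiv.swap_apply_left, Equiv.swap_apply_right]
    ring
  have e : of Vq' - of Vq = -((of Vq - of (Vq.reindex (Equiv.swap (0 : Fin 2) 1))) +
      (of (Vq.reindex (Equiv.swap (0 : Fin 2) 1)) - of Vq')) := by abel
  rw [e]
  exact relations.neg_mem (relations.add_mem h1 h2)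

/-! ## The registered stub -/

/-- **Stub `isl_partialFraction_T` (the triple-pole atom of the product island at height `q`).**
For box representations `Tq, D, Vq, Vq', P` on `□²` with the island integrands
`q(q−1)/((q−x₀)(q−x₁)(q−x₀x₁))`, `1/(q−x₀x₁)`, `q/((q−x₀)(q−x₀x₁))`, `q/((q−x₁)(q−x₀x₁))`,
`1/((q−x₀)(q−x₁))`:
(1) `[Tq] + [D] − [Vq] − [Vq'] + [P] ∈ relations` (the partial fraction of the triple pole, rule
(1b));
(2) `[Vq'] − [Vq] ∈ relations` (the coordinate swap, rule (2)).
[cite: KontsevichZagier2001, §1.2 rules (1), (2)] -/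
theorem isl_partialFraction_T :
    ∀ (q : ℕ), 2 ≤ q → ∀ (Tq D Vq Vq' P : IntegralRep 2),
      Tq.domain = {x | ∀ i, x i ∈ Set.Ioo (0:ℝ) 1} →
      EqOn Tq.integrand (fun x => (q:ℝ) * ((q:ℝ) - 1) /
        (((q:ℝ) - x 0) * ((q:ℝ) - x 1) * ((q:ℝ) - x 0 * x 1))) Tq.domain →
      D.domain = {x | ∀ i, x i ∈ Set.Ioo (0:ℝ) 1} →
      EqOn D.integrand (fun x => 1 / ((q:ℝ) - x 0 * x 1)) D.domain →
      Vq.domain = {x | ∀ i, x i ∈ Set.Ioo (0:ℝ) 1} →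
      EqOn Vq.integrand (fun x => (q:ℝ) / (((q:ℝ) - x 0) * ((q:ℝ) - x 0 * x 1))) Vq.domain →
      Vq'.domain = {x | ∀ i, x i ∈ Set.Ioo (0:ℝ) 1} →
      EqOn Vq'.integrand (fun x => (q:ℝ) / (((q:ℝ) - x 1) * ((q:ℝ) - x 0 * x 1))) Vq'.domain →
      P.domain = {x | ∀ i, x i ∈ Set.Ioo (0:ℝ) 1} →
      EqOn P.integrand (fun x => 1 / (((q:ℝ) - x 0) * ((q:ℝ) - x 1))) P.domain →
      (of Tq + of D - of Vq - of Vq' + of P ∈ relations) ∧ (of Vq' - of Vq ∈ relations) := by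
  intro q hq Tq D Vq Vq' P hTd hTi hDd hDi hVd hVi hV'd hV'i hPd hPi
  exact ⟨islT_triplePole_mem_relations hq Tq D Vq Vq' P hTd hTi hDd hDi hVd hVi hV'd hV'i hPd hPi,
    islT_swap_mem_relations q Vq Vq' hVd hVi hV'd hV'i⟩

end Summit.KontsevichZagierPeriods.HurwitzMicroSectors.NormalFormPrinciple.PiBox.Island
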